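import Literature.Topology.FourManifolds.ClosedBallSmoothEmbeddings
import Literature.Topology.FourManifolds.ClosedBallExtension
import Literature.Topology.FourManifolds.ClosedBallTangent
import Mathlib.Geometry.Manifold.PartitionOfUnity
import HarnessLib

/-!
# The intrinsic embedding criterion for closed discs `𝔻ⁿ⁺¹ → N`

Helper file (`--supports stmt-SmoothPoincare4-18000`, stub `stub_boundsDisc_of_annularChart` of
the registered skeleton `Cruxes/DependentTripleGenusThreeStandard/Lines/Sketch.lean`).

`ClosedBallSmoothEmbeddings.lean` proves that the RESTRICTION `F ∘ Subtype.val` to the closed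
unit ball `𝔻ⁿ⁺¹ ⊆ ℝⁿ⁺¹` (manifold with boundary, model `𝓡∂ (n + 1)`, `ClosedBall.lean`) of an
ambient map `F : ℝⁿ⁺¹ → N` which is `C^∞`, injective on `𝔻ⁿ⁺¹` and has injective differential
there is a smooth embedding in Mathlib's chart sense (`Manifold.IsSmoothEmbedding`).  Here is the
INTRINSIC form, for a map given only on the manifold with boundary `𝔻ⁿ⁺¹`:

* `isImmersionAtOfComplement_closedBall_of_injective_mfderiv` — a `C^∞` map `f : 𝔻ⁿ⁺¹ → N`
  (`N` modelled on `ℝᵐ`) with injective differential `mfderiv (𝓡∂ (n+1)) (𝓡 m) f x` at `x` is a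
  `C^∞` immersion at `x` (complement `ℝᵏ`, `k = m - (n + 1)`): cut `f` off by a smooth bump of
  `𝔻ⁿ⁺¹` supported in the preimage of a chart at `f x`, read it in that chart, extend the
  resulting `C^∞` map `𝔻ⁿ⁺¹ → ℝᵐ` to `ℝⁿ⁺¹` (Seeley's theorem,
  `exists_contDiff_extension_of_contMDiff_closedBall`), pull back by the chart: this is an ambient
  `C^∞` map `F` near `x` with `f = F ∘ Subtype.val` near `x`, whose differential at `x` is
  injective because `d(Subtype.val)_x = closedBallCoeDeriv x` is invertible
  (`mfderiv_coe_closedBall`); conclude by `isImmersionAtOfComplement_comp_coe_closedBall` and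
  locality of immersions;
* `helper_isSmoothEmbedding_closedBall_of_injective_mfderiv` (REGISTERED helper) — hence a `C^∞`
  injective `f : 𝔻ⁿ⁺¹ → N` with everywhere injective differential into a Hausdorff `N` is a
  smooth embedding of the manifold with boundary `𝔻ⁿ⁺¹` (Hirsch, Ch. 1 §3, Thm. 3.1).

Everything is proved; no definitions, no named facts.

References: J. M. Lee, *Introduction to Smooth Manifolds* (2013), Lemma 2.26, Thm. 4.12,
Prop. 5.22; R. T. Seeley, Proc. AMS 15 (1964); M. W. Hirsch, *Differential Topology* (1976),
Ch. 1 §3 Thm. 3.1.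
-/

-- the registered namespace `Summit.SmoothPoincare4.SmoothPoincare4.Theorems…` repeats a component
set_option linter.dupNamespace false

noncomputable section

open scoped Manifold ContDiff Topology ContinuousMap
open Set Function Metric Module
open Literature.Topology.FourManifolds

namespace Summit.SmoothPoincare4.SmoothPoincare4.Theorems

variable {m n : ℕ} {N : Type*} [TopologicalSpace N] [ChartedSpace (EuclideanSpace ℝ (Fin m)) N]
  [IsManifold (𝓡 m) ∞ N]

/-- **A `C^∞` map of the closed disc with injective differential at `x` is an immersion at `x`**
(intrinsic form, manifold with boundary `𝔻ⁿ⁺¹`, complement `ℝᵏ`, `k = m - (n + 1)`): localise by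
a bump, read in a chart at `f x`, extend to `ℝⁿ⁺¹` by Seeley's theorem, and apply the ambient
criterion `isImmersionAtOfComplement_comp_coe_closedBall`.
[cite: LeeSmoothManifolds2013, Lemma 2.26 and Ch. 5 Prop. 5.22] -/
theorem isImmersionAtOfComplement_closedBall_of_injective_mfderiv
    {f : Metric.closedBall (0 : EuclideanSpace ℝ (Fin (n + 1))) 1 → N}
    (hf : ContMDiff (𝓡∂ (n + 1)) (𝓡 m) ∞ f)
    (x : Metric.closedBall (0 : EuclideanSpace ℝ (Fin (n + 1))) 1)
    (hx : Injective (mfderiv (𝓡∂ (n + 1)) (𝓡 m) f x)) :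
    Manifold.IsImmersionAtOfComplement
      (Fin (finrank ℝ (EuclideanSpace ℝ (Fin m)) - finrank ℝ (EuclideanSpace ℝ (Fin (n + 1)))) → ℝ)
      (𝓡∂ (n + 1)) (𝓡 m) ∞ f x := by
  classical
  haveI : CompactSpace (Metric.closedBall (0 : EuclideanSpace ℝ (Fin (n + 1))) 1) :=
    isCompact_iff_compactSpace.mp (isCompact_closedBall _ _)
  -- the chart at `f x` and an open ball of the disc mapped into its source
  set χ := extChartAt (𝓡 m) (f x) with hχ
  set V : Set (Metric.closedBall (0 : EuclideanSpace ℝ (Fin (n + 1))) 1) :=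
    f ⁻¹' (chartAt (EuclideanSpace ℝ (Fin m)) (f x)).source with hV
  have hVo : IsOpen V := (chartAt _ (f x)).open_source.preimage hf.continuous
  have hxV : x ∈ V := mem_chart_source _ (f x)
  obtain ⟨ε, hε, hεV⟩ := Metric.isOpen_iff.1 hVo x hxV
  -- a smooth bump: `1` on `closedBall x (ε/4)`, `0` off `ball x (ε/2)`
  obtain ⟨φ, hφ0, hφ1, -⟩ :=
    exists_contMDiffMap_zero_one_of_isClosed (I := 𝓡∂ (n + 1)) (n := (⊤ : ℕ∞))
      (M := Metric.closedBall (0 : EuclideanSpace ℝ (Fin (n + 1))) 1)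
      (s := (ball x (ε / 2))ᶜ) (t := closedBall x (ε / 4)) isOpen_ball.isClosed_compl
      isClosed_closedBall
      (disjoint_compl_left_iff_subset.2 (closedBall_subset_ball (by linarith)))
  -- the localised chart expression of `f`
  set G : Metric.closedBall (0 : EuclideanSpace ℝ (Fin (n + 1))) 1 → EuclideanSpace ℝ (Fin m) :=
    fun y => φ y • χ (f y) with hG
  have hGs : ContMDiff (𝓡∂ (n + 1)) 𝓘(ℝ, EuclideanSpace ℝ (Fin m)) ∞ G := by
    intro y
    by_cases hy : y ∈ ball x ε
    · have hyV : y ∈ V := hεV hy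
      have h1 : ContMDiffAt (𝓡∂ (n + 1)) 𝓘(ℝ, EuclideanSpace ℝ (Fin m)) ∞ (fun z => χ (f z)) y :=
        (contMDiffAt_extChartAt' (I := 𝓡 m) (n := ∞) hyV).comp y (hf y)
      exact (φ.contMDiff y).smul h1
    · have hnhds : (closedBall x (ε / 2))ᶜ ∈ 𝓝 y := by
        refine isClosed_closedBall.isOpen_compl.mem_nhds ?_
        intro hy'
        exact hy (closedBall_subset_ball (by linarith) hy')
      have hev : G =ᶠ[𝓝 y] fun _ => 0 := by
        filter_upwards [hnhds] with z hz
        have hz' : z ∈ (ball x (ε / 2))ᶜ := fun hz'' => hz (ball_subset_closedBall hz'')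
        simp only [hG, hφ0 hz', Pi.zero_apply, zero_smul]
      exact contMDiffAt_const.congr_of_eventuallyEq hev
  -- Seeley extension to the ambient Euclidean space
  obtain ⟨g, hg, hgG⟩ := exists_contDiff_extension_of_contMDiff_closedBall G hGs
  -- the ambient map near `x`
  set F : EuclideanSpace ℝ (Fin (n + 1)) → N := fun z => χ.symm (g z) with hF
  set W : Set (EuclideanSpace ℝ (Fin (n + 1))) := g ⁻¹' χ.target with hW
  have hWo : IsOpen W := (isOpen_extChartAt_target (I := 𝓡 m) (f x)).preimage hg.continuous
  have hφx : φ x = 1 := hφ1 (mem_closedBall_self (by positivity))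
  have hgx : g (x : EuclideanSpace ℝ (Fin (n + 1))) = χ (f x) := by
    rw [hgG x]
    simp only [hG, hφx, one_smul]
  have hxW : (x : EuclideanSpace ℝ (Fin (n + 1))) ∈ W := by
    show g x ∈ χ.target
    rw [hgx]
    exact mem_extChartAt_target (f x)
  have hFs : ContMDiffOn 𝓘(ℝ, EuclideanSpace ℝ (Fin (n + 1))) (𝓡 m) ∞ F W :=
    (contMDiffOn_extChartAt_symm (I := 𝓡 m) (n := ∞) (f x)).comp
      hg.contMDiff.contMDiffOn fun z hz => hz
  -- `f = F ∘ Subtype.val` near `x`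
  have heq : (F ∘ Subtype.val) =ᶠ[𝓝 x] f := by
    have hnhds : ball x (ε / 4) ∈ 𝓝 x := isOpen_ball.mem_nhds (mem_ball_self (by positivity))
    filter_upwards [hnhds] with y hy
    have hyV : y ∈ V := hεV (ball_subset_ball (by linarith) hy)
    have hφy : φ y = 1 := hφ1 (ball_subset_closedBall hy)
    simp only [comp_apply, hF, hgG y, hG, hφy, one_smul]
    exact χ.left_inv (by rwa [hχ, extChartAt_source])
  -- the differential of `F` at `x` is injective
  have hFx : ContMDiffAt 𝓘(ℝ, EuclideanSpace ℝ (Fin (n + 1))) (𝓡 m) ∞ F x :=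
    (hFs _ hxW).contMDiffAt (hWo.mem_nhds hxW)
  have hFd : MDifferentiableAt 𝓘(ℝ, EuclideanSpace ℝ (Fin (n + 1))) (𝓡 m) F x :=
    hFx.mdifferentiableAt (by simp)
  have hcomp : mfderiv (𝓡∂ (n + 1)) (𝓡 m) f x =
      (mfderiv 𝓘(ℝ, EuclideanSpace ℝ (Fin (n + 1))) (𝓡 m) F x).comp
        (closedBallCoeDeriv x : EuclideanSpace ℝ (Fin (n + 1)) →L[ℝ] EuclideanSpace ℝ (Fin (n + 1))) := by
    rw [← heq.mfderiv_eq, ← mfderiv_coe_closedBall x]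
    exact mfderiv_comp x hFd (hasMFDerivAt_coe_closedBall x).mdifferentiableAt
  have hinjF : Injective (mfderiv 𝓘(ℝ, EuclideanSpace ℝ (Fin (n + 1))) (𝓡 m) F x) := by
    rw [hcomp] at hx
    exact Injective.of_comp_right hx (closedBallCoeDeriv x).surjective
  have hFimm : Manifold.IsImmersionAtOfComplement
      (Fin (finrank ℝ (EuclideanSpace ℝ (Fin m)) - finrank ℝ (EuclideanSpace ℝ (Fin (n + 1)))) → ℝ)
      𝓘(ℝ, EuclideanSpace ℝ (Fin (n + 1))) (𝓡 m) ∞ F x :=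
    isImmersionAtOfComplement_of_injective_mfderiv hWo hxW hFs (by exact_mod_cast le_top) hinjF
  exact (isImmersionAtOfComplement_comp_coe_closedBall hFimm).congr_of_eventuallyEq heq

/-- **The intrinsic embedding criterion for closed discs** (REGISTERED helper of the crux
`DependentTripleGenusThreeStandard`, line `Sketch`): a `C^∞` injective map `f : 𝔻ⁿ⁺¹ → N` of
the closed unit ball (manifold with boundary, model `𝓡∂ (n + 1)`) into a Hausdorff manifold
modelled on `ℝᵐ`, with injective differential at every point, is a smooth embedding in
Mathlib's chart sense: an immersion by
`isImmersionAtOfComplement_closedBall_of_injective_mfderiv` (one complement `ℝᵏ` for all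
points), a topological embedding as a continuous injection of a compact space into a Hausdorff
space. [cite: HirschDT1976, Ch. 1 §3 Thm. 3.1] -/
theorem helper_isSmoothEmbedding_closedBall_of_injective_mfderiv :
    ∀ (m n : ℕ) (N : Type) [TopologicalSpace N] [T2Space N]
      [ChartedSpace (EuclideanSpace ℝ (Fin m)) N] [IsManifold (𝓡 m) ∞ N]
      (f : Metric.closedBall (0 : EuclideanSpace ℝ (Fin (n + 1))) 1 → N),
      ContMDiff (𝓡∂ (n + 1)) (𝓡 m) ∞ f → Function.Injective f →
      (∀ x, Function.Injective (mfderiv (𝓡∂ (n + 1)) (𝓡 m) f x)) →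
      Manifold.IsSmoothEmbedding (𝓡∂ (n + 1)) (𝓡 m) ∞ f := by
  intro m n N _ _ _ _ f hf hinj hd
  haveI : CompactSpace (Metric.closedBall (0 : EuclideanSpace ℝ (Fin (n + 1))) 1) :=
    isCompact_iff_compactSpace.mp (isCompact_closedBall _ _)
  refine ⟨Manifold.IsImmersionOfComplement.isImmersion fun x =>
    isImmersionAtOfComplement_closedBall_of_injective_mfderiv hf x (hd x), ?_⟩
  exact (hf.continuous.isClosedEmbedding hinj).isEmbedding

end Summit.SmoothPoincare4.SmoothPoincare4.Theorems

end
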